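import Summits.AnomalousDissipation.AnomalousDissipation.Theorems.TwoAndHalfDScalarAnomalySteadySourceFormalReleaseL2Floor
import Summits.AnomalousDissipation.AnomalousDissipation.Theorems.TwoAndHalfDScalarAnomalySteadySourceFormalReleaseNormSqMeasurable
import HarnessLib

/-!
# No uniformly Lipschitz realisation of the MEAN-SQUARE clause of S1''

Tool file of the line `budgeted-mixer-template`, reshape r2 (lead c2), for the crux
`Summit.AnomalousDissipation.AnomalousDissipation.Theses.TwoAndHalfD.ScalarAnomalySteadySourceFormal`
(stmt-AnomalousDissipation-0448).  The reshaped residual S1'' (`stub_meanSquareMixerRealizable`) replaces the pointwise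
release majorant of S1' by the statistical clause

  (MS)  `∫_{s₀}^{T} ‖φ_j s (s+τ)‖² ds ≤ (B + (T − s₀)) · m(τ)² ‖h‖²`  (`τ ≥ 0`, `T ≥ s₀`; `m > 0` antitone, `∫₀ᵗ m ≤ M`).

THIS FILE certifies that the weakening does not re-open the uniformly-Lipschitz door: exactly like the (Decay) clause of S1'
(`ReleaseL2Floor.decay_clause_not_uniformlyLipschitz`, p118298), (MS) is INCOMPATIBLE, along `ν_j → 0`, with velocity
gradients bounded in quadratic form by one constant `Λ₀` uniformly in `j`, `t ≥ 0`, `x` — so every S1''-witness has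
`sup_{t,x} ‖∇v_j‖ → ∞` (drefute NC3 / Disproof §5(e) for mean-square witnesses).

PROOF (`meanSquare_clause_not_uniformlyLipschitz`).  Poon's floor in constant form (`ReleaseL2Floor.scalarL2Sq_sub_le_of_const`)
gives, for EVERY release time `s ≥ 0` and every `j`, `‖φ_j s (s+τ)‖² ≥ ‖h‖² − 2ν_j τ e^{2Λ₀τ} ‖∇h‖²` — a bound independent of
`s`.  The release norms are honest integrands (measurable by T3a `ReleaseNormSqMeasurable.stub_releaseNormSqMeasurable`, p147918,
bounded by `‖h‖²` by contraction), so integrating over `s ∈ [s₀, T]` and comparing with (MS):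
`(T − s₀)(‖h‖² − 2ν_jτe^{2Λ₀τ}‖∇h‖²) ≤ (B + T − s₀) m(τ)²‖h‖²` for all `T ≥ s₀`, whence (let `T → ∞`)
`‖h‖²(1 − m(τ)²) ≤ 2ν_j τ e^{2Λ₀τ}‖∇h‖²` for all `j`, and (let `j → ∞`) `m(τ) ≥ 1` for every `τ ≥ 0`; but `τ·m(τ) ≤ ∫₀^τ m ≤ M`
(antitone) forces `m(τ) < 1` at `τ = M + 1`.  Registered tool stub `stub_meanSquareLipschitzNoGo`.
Supports stmt-AnomalousDissipation-0448. [folklore; Poon 1996, Miles–Doering 2018 §2]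
-/

noncomputable section

-- D-0017: single-problem summit ⇒ `Summit.AnomalousDissipation.AnomalousDissipation.…` repeats a namespace component
set_option linter.dupNamespace false

namespace Summit.AnomalousDissipation.AnomalousDissipation.Theorems.ScalarAnomalySteadySourceFormal.MeanSquareLipschitzNoGo

open MeasureTheory Set Filter Topology
open scoped InnerProductSpace
open Literature.Analysis.FunctionSpaces Literature.Analysis.FluidPDE
open Summit.AnomalousDissipation.AnomalousDissipation.Theorems.ScalarAnomalySteadySourceFormal

/-! ## Real-variable bookkeeping -/

/-- If `(T - s₀) c ≤ (B + (T - s₀)) d` for every `T ≥ s₀` (with `B ≥ 0`), then `c ≤ d`: with `L = T - s₀ ≥ 0` the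
hypothesis reads `L (c - d) ≤ B d`, impossible for large `L` when `c > d`. [folklore] -/
theorem le_of_forall_linear_le {s₀ B c d : ℝ} (hB : 0 ≤ B)
    (h : ∀ T, s₀ ≤ T → (T - s₀) * c ≤ (B + (T - s₀)) * d) : c ≤ d := by
  by_contra hcd
  have hcd : d < c := lt_of_not_ge hcd
  have key : ∀ L, 0 ≤ L → L * (c - d) ≤ B * d := by
    intro L hL
    have := h (s₀ + L) (by linarith)
    rw [show s₀ + L - s₀ = L by ring] at this
    nlinarith
  have hpos : 0 < c - d := sub_pos.2 hcd
  rcases le_or_gt d 0 with hd | hd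
  · have h1 := key 1 zero_le_one
    have : B * d ≤ 0 := mul_nonpos_of_nonneg_of_nonpos hB hd
    linarith
  · have hL : 0 ≤ B * d / (c - d) + 1 := by positivity
    have h1 := key _ hL
    rw [add_mul, div_mul_cancel₀ _ hpos.ne'] at h1
    linarith

/-- An antitone `m` with `∫₀ᵗ m ≤ M` for all `t ≥ 0` satisfies `t · m t ≤ M` (`t ≥ 0`). [folklore] -/
theorem mul_le_of_antitone_integral_le {m : ℝ → ℝ} {M t : ℝ} (hanti : Antitone m)
    (hM : ∀ t, 0 ≤ t → ∫ τ in (0 : ℝ)..t, m τ ≤ M) (ht : 0 ≤ t) : t * m t ≤ M := by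
  have hint : IntervalIntegrable m volume 0 t := hanti.intervalIntegrable
  have hlow : ∫ _r in (0 : ℝ)..t, m t ≤ ∫ r in (0 : ℝ)..t, m r :=
    intervalIntegral.integral_mono_on ht (continuous_const.intervalIntegrable _ _) hint fun r hr => hanti hr.2
  rw [intervalIntegral.integral_const, smul_eq_mul, sub_zero] at hlow
  exact hlow.trans (hM t ht)

/-! ## The no-go -/

/-- **No uniformly Lipschitz realisation of the (MS) clause of S1''.**  Let `ν_j > 0`, `ν_j → 0`; for each `j` let `φ j s`
(`s ≥ 0`) be classical unforced releases of ONE smooth `h ≠ 0` (in `L²`) over a drift `v j` (jointly smooth, divergence free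
on `[0,∞)` by the structure); let `m > 0` be antitone with `∫₀ᵗ m ≤ M` (`t ≥ 0`), `s₀, B ≥ 0`, and assume the mean-square
clause (MS) of `stub_meanSquareMixerRealizable`.  If the velocity gradients are bounded in quadratic form by ONE constant,
`|⟪ξ, Dv_j(t,x) ξ⟫| ≤ Λ₀‖ξ‖²` for all `j`, `t ≥ 0`, `x`, `ξ`, then `False`. [folklore; Poon 1996, Miles–Doering 2018 §2] -/
theorem meanSquare_clause_not_uniformlyLipschitz {ν : ℕ → ℝ}
    {v : ℕ → ℝ → UnitAddTorus (Fin 2) → EuclideanSpace ℝ (Fin 2)} {h : UnitAddTorus (Fin 2) → ℝ}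
    {φ : ℕ → ℝ → ℝ → UnitAddTorus (Fin 2) → ℝ} {m : ℝ → ℝ} {s₀ B M Λ₀ : ℝ}
    (hν : ∀ j, 0 < ν j) (hν0 : Tendsto ν atTop (𝓝 0))
    (hh : Torus.IsSmooth h) (hh0 : Torus.scalarL2Sq h ≠ 0)
    (hφ : ∀ j s, 0 ≤ s → Torus.IsClassicalScalarTransportOn (Ici s) (ν j) (v j) (φ j s) ∧ φ j s s = h)
    (hs₀ : 0 ≤ s₀) (hB : 0 ≤ B) (hanti : Antitone m) (hpos : ∀ τ, 0 < m τ)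
    (hM : ∀ t, 0 ≤ t → ∫ τ in (0 : ℝ)..t, m τ ≤ M)
    (hMS : ∀ j τ T, 0 ≤ τ → s₀ ≤ T →
      ∫ s in s₀..T, Torus.scalarL2Sq (φ j s (s + τ)) ≤ (B + (T - s₀)) * m τ ^ 2 * Torus.scalarL2Sq h)
    (hΛ₀ : 0 ≤ Λ₀)
    (hLip : ∀ j, ∀ t ∈ Ici (0 : ℝ), ∀ (x : UnitAddTorus (Fin 2)) (ξ : EuclideanSpace ℝ (Fin 2)),
      |⟪ξ, Torus.fderiv (v j t) x ξ⟫_ℝ| ≤ Λ₀ * ‖ξ‖ ^ 2) : False := by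
  set N : ℝ := Torus.scalarL2Sq h with hN_def
  set G₀ : ℝ := Torus.scalarGradNormSq h with hG₀_def
  have hN_pos : 0 < N := lt_of_le_of_ne (Torus.scalarL2Sq_nonneg h) (Ne.symm hh0)
  have hG₀ : 0 ≤ G₀ := Torus.scalarGradNormSq_nonneg h
  -- the lag: `τ := M + 1`; there `m τ < 1`
  have hM0 : 0 < M := by
    have h1 := mul_le_of_antitone_integral_le hanti hM (zero_le_one)
    rw [one_mul] at h1
    exact lt_of_lt_of_le (hpos 1) h1
  set τ : ℝ := M + 1 with hτ_def
  have hτ : 0 < τ := by rw [hτ_def]; linarith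
  have hmτ : m τ < 1 := by
    have h1 := mul_le_of_antitone_integral_le hanti hM hτ.le
    -- `τ m τ ≤ M < τ`
    by_contra hge
    have hge : 1 ≤ m τ := le_of_not_gt hge
    have : τ ≤ τ * m τ := by nlinarith [hpos τ]
    linarith
  -- Step 1: the `s`-independent Poon floor for every release, every `j`
  have hfloor : ∀ j s, 0 ≤ s →
      N - 2 * ν j * τ * Real.exp (2 * Λ₀ * τ) * G₀ ≤ Torus.scalarL2Sq (φ j s (s + τ)) := by
    intro j s hs
    have hsol := (hφ j s hs).1
    have hst : s < s + τ := by linarith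
    have hres : Torus.IsClassicalScalarTransportOn (Icc s (s + τ)) (ν j) (v j) (φ j s) :=
      hsol.restrict_Icc hst Icc_subset_Ici_self
    have hLipw : ∀ t ∈ Icc s (s + τ), ∀ (x : UnitAddTorus (Fin 2)) (ξ : EuclideanSpace ℝ (Fin 2)),
        |⟪ξ, Torus.fderiv (v j t) x ξ⟫_ℝ| ≤ Λ₀ * ‖ξ‖ ^ 2 := fun t ht => hLip j t (mem_Ici.2 (hs.trans ht.1))
    have key := ReleaseL2Floor.scalarL2Sq_sub_le_of_const (hν j).le hst hΛ₀ hres hLipw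
      (t := s + τ) ⟨hst.le, le_rfl⟩
    rw [(hφ j s hs).2, show s + τ - s = τ by ring] at key
    linarith
  -- Step 2: integrate over the release time and compare with (MS): `c_j ≤ m τ ^ 2 * N`
  have hcmp : ∀ j, N - 2 * ν j * τ * Real.exp (2 * Λ₀ * τ) * G₀ ≤ m τ ^ 2 * N := by
    intro j
    -- measurable version of the release norms (T3a)
    obtain ⟨G, hGm, hGeq⟩ := ReleaseNormSqMeasurable.stub_releaseNormSqMeasurable (ν j) (v j) h (φ j) (hν j) hh (hφ j)
    refine le_of_forall_linear_le (s₀ := s₀) (B := B) hB fun T hT => ?_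
    have hMS' := hMS j τ T hτ.le hT
    -- lower bound of the (MS) integral by `(T - s₀) c_j`
    have hmeas : Measurable fun s => G (s, s + τ) :=
      hGm.comp (measurable_id.prodMk (measurable_id.add_const τ))
    have hbdd : ∀ s ∈ Icc s₀ T, |G (s, s + τ)| ≤ N := by
      intro s hs
      have hs0 : 0 ≤ s := hs₀.trans hs.1
      rw [hGeq s (s + τ) hs0 (by linarith)]
      have hsol := (hφ j s hs0).1
      have hanti' := hsol.antitoneOn_scalarL2Sq (hν j).le (a := s) (b := s + τ) Icc_subset_Ici_self
        (left_mem_Icc.2 (by linarith)) (right_mem_Icc.2 (by linarith)) (by linarith)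
      simp only [(hφ j s hs0).2] at hanti'
      rw [abs_of_nonneg (Torus.scalarL2Sq_nonneg _)]
      exact hanti'
    have hint : IntervalIntegrable (fun s => G (s, s + τ)) volume s₀ T := by
      refine (intervalIntegrable_iff_integrableOn_Icc_of_le hT).2 ?_
      refine Measure.integrableOn_of_bounded (M := N) measure_Icc_lt_top.ne hmeas.aestronglyMeasurable ?_
      exact (ae_restrict_iff' measurableSet_Icc).2 (Eventually.of_forall fun s hs => by
        rw [Real.norm_eq_abs]; exact hbdd s hs)
    have hcongr : ∫ s in s₀..T, Torus.scalarL2Sq (φ j s (s + τ)) = ∫ s in s₀..T, G (s, s + τ) := by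
      refine intervalIntegral.integral_congr fun s hs => ?_
      rw [uIcc_of_le hT] at hs
      exact (hGeq s (s + τ) (hs₀.trans hs.1) (by linarith)).symm
    have hlow : ∫ _s in s₀..T, (N - 2 * ν j * τ * Real.exp (2 * Λ₀ * τ) * G₀) ≤ ∫ s in s₀..T, G (s, s + τ) := by
      refine intervalIntegral.integral_mono_on hT (continuous_const.intervalIntegrable _ _) hint fun s hs => ?_
      rw [hGeq s (s + τ) (hs₀.trans hs.1) (by linarith)]
      exact hfloor j s (hs₀.trans hs.1)
    rw [intervalIntegral.integral_const, smul_eq_mul] at hlow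
    rw [hcongr] at hMS'
    calc (T - s₀) * (N - 2 * ν j * τ * Real.exp (2 * Λ₀ * τ) * G₀)
        ≤ ∫ s in s₀..T, G (s, s + τ) := hlow
      _ ≤ (B + (T - s₀)) * m τ ^ 2 * Torus.scalarL2Sq h := hMS'
      _ = (B + (T - s₀)) * (m τ ^ 2 * N) := by rw [hN_def]; ring
  -- Step 3: let `j → ∞`: `N (1 - m τ ^ 2) ≤ 0`, contradicting `m τ < 1`
  have hgap : 0 < N * (1 - m τ ^ 2) := by
    have : m τ ^ 2 < 1 := by
      have := hpos τ
      nlinarith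
    exact mul_pos hN_pos (by linarith)
  set K : ℝ := 2 * τ * Real.exp (2 * Λ₀ * τ) * G₀ with hK_def
  have hK : 0 ≤ K := by rw [hK_def]; positivity
  -- `N (1 - m τ²) ≤ ν j * K` for all `j`
  have hj : ∀ j, N * (1 - m τ ^ 2) ≤ ν j * K := by
    intro j
    have := hcmp j
    rw [hK_def]
    nlinarith
  -- `ν j * K → 0`
  have hlim : Tendsto (fun j => ν j * K) atTop (𝓝 0) := by
    simpa using hν0.mul_const K
  have hev := hlim.eventually (gt_mem_nhds hgap)
  obtain ⟨j, hj'⟩ := hev.exists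
  exact absurd (hj j) (not_le.2 hj')

/-! ## Registered tool stub -/

/-- **Registered tool stub `stub_meanSquareLipschitzNoGo`** (`ledger workitem stub-add stmt-AnomalousDissipation-0448 …`):
the mean-square clause (MS) of S1'' together with a `j`-uniform quadratic-form bound on the velocity gradients is
contradictory along `ν_j → 0` — every S1''-witness has unbounded gradients (explicit form of
`meanSquare_clause_not_uniformlyLipschitz`). [folklore; Poon 1996, Miles–Doering 2018 §2] -/
theorem stub_meanSquareLipschitzNoGo :
    ∀ (ν : ℕ → ℝ) (v : ℕ → ℝ → UnitAddTorus (Fin 2) → EuclideanSpace ℝ (Fin 2)) (h : UnitAddTorus (Fin 2) → ℝ)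
      (φ : ℕ → ℝ → ℝ → UnitAddTorus (Fin 2) → ℝ) (m : ℝ → ℝ) (s₀ B M Λ₀ : ℝ),
      (∀ j, 0 < ν j) → Tendsto ν atTop (𝓝 0) → Torus.IsSmooth h → Torus.scalarL2Sq h ≠ 0 →
      (∀ j s, 0 ≤ s → Torus.IsClassicalScalarTransportOn (Set.Ici s) (ν j) (v j) (φ j s) ∧ φ j s s = h) →
      0 ≤ s₀ → 0 ≤ B → Antitone m → (∀ τ, 0 < m τ) → (∀ t, 0 ≤ t → ∫ τ in (0 : ℝ)..t, m τ ≤ M) →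
      (∀ j τ T, 0 ≤ τ → s₀ ≤ T →
        ∫ s in s₀..T, Torus.scalarL2Sq (φ j s (s + τ)) ≤ (B + (T - s₀)) * m τ ^ 2 * Torus.scalarL2Sq h) →
      0 ≤ Λ₀ →
      (∀ j, ∀ t ∈ Set.Ici (0 : ℝ), ∀ (x : UnitAddTorus (Fin 2)) (ξ : EuclideanSpace ℝ (Fin 2)),
        |⟪ξ, Torus.fderiv (v j t) x ξ⟫_ℝ| ≤ Λ₀ * ‖ξ‖ ^ 2) →
      False :=
  fun _ν _v _h _φ _m _s₀ _B _M _Λ₀ hν hν0 hh hh0 hφ hs₀ hB hanti hpos hM hMS hΛ₀ hLip =>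
    meanSquare_clause_not_uniformlyLipschitz hν hν0 hh hh0 hφ hs₀ hB hanti hpos hM hMS hΛ₀ hLip

end Summit.AnomalousDissipation.AnomalousDissipation.Theorems.ScalarAnomalySteadySourceFormal.MeanSquareLipschitzNoGo

end
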